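import Summits.BirchSwinnertonDyer.Rank1Residual.Additive.WildThreeKrausCells
import Literature.NumberTheory.EllipticCurves.PlusMinusPAdicLFunction
import HarnessLib

/-!
# BSD rank-≤1 residual cell, class O6 (WILD `p = 3`): the cyclotomic-tower INTERFACES of T-O6-ν —
# the tower valuation datum `ν_k`, the isogeny-class level profile, and their pure arithmetic
# (Kodaira offset `ℓ`, slope `m`, effective level `ℓ′`) — ROBUST PARTS ONLY; no law is typed

HONEST FRAMING (cell `b2b-bsdres-*`, run/shared/lean/b2b/bsd-rank1-residual/, verbatim): the goal
of the cell is to DELETE the COMBINATION-SHAPED residual classes for ALL analytic-rank `≤ 1` elliptic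
curves over `ℚ`, not to book instances; census / certificate output is EVIDENCE, never a Literature
fact; nothing here is booked, no mark is moved, O6 stays OPEN. This file types INTERFACES (two
`structure`s whose fields NAME data Lean cannot yet define), arithmetic `def`s with proved values,
and two CONSTRUCTION-statement SHAPES over interface predicates; 0 `@[conjecture]` nodes, 0 named
Literature facts, nothing asserted.

## What is typed and what is deliberately NOT (CLASS-CLOSURE lane, typer 5 = O5/O6 typer of record;
## ask A-O6-T1 of o6-r1 GEN 3, INBOX 2026-08-21T06:42Z; content = o6-r1 GEN 2 `HOME/b2b-bsdres-o6-r1/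
## O6Towers.lean` (sha16 82d8833c9083d2b9) §1, §2, §3bis; placement/dedup/status = class typer)

o6-r1's instrument T-O6-ν reads, on the CYCLIC wild cell at `3` (`Additive.SubWCyclic`), the common
`3`-adic valuation `ν_k(E)` of `τ(ψ)·L(E, ψ̄, 1)/Ω⁺_E` over the even primitive Dirichlet characters `ψ`
of conductor `3^{k+1}` (well defined because `θ_k = ω_{k−1}·u_k` with `deg u_k < φ(3^k)` — the
divisibility `ω_{k−1} ∣ θ_k` at an additive prime, Doyon–Lei Lemma 5.2 / proof of Cor. 5.3, typed for
the whole additive locus as `Additive.OmegaDvdMazurTateOfAddv` in `Additive/OmegaDvdMazurTateAddv.lean`)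
and conjectures a LAW `ν_k = ℓ′(E) + ε/φ(3^k)` (`k ≥ k₀`). STATUS OF THE LAW (`O6-TOWERS.md` §3.3,
`cells/o5o6/TARGETS.md` §O6): **v1** (level = Kodaira offset `ℓ(v₃Δ_min)` alone, `ε ∈ {−2..1}`) was
REFUTED on its pre-registered held-out band (H-1: 41/68, kit j121686); **v2** (isogeny-class level
`ℓ′`, `k₀ ≤ 3`) held 19/20 on pre-registration 3 but was REFUTED 1/20 by its own kill rule (14742c1,
anomalous layer, kit j121756; the `k = 5` follow-up j122743 matched the pre-job prediction); **v3**
(`k₀ := 1 +` last anomalous layer; isogeny-class MAX level rule; parity; anomalous-layer rate) is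
PRE-REGISTRATION 4 (`ttrl/requests.jsonl` l.1487), to be scored on band C1′ (all cyclic
`8000 < N ≤ 20000`, `k ≤ 4`). By the lane rule "no refuted statement becomes an `@[conjecture]`
node" (o6-r1 GEN 3 agrees), NO version of the law is typed here; v3 is typed when C1′ is scored, with
its report sha. What IS typed — the parts every version shares:

* §1 the Kodaira offset `kodairaOffset v = (v+2)/12 + [6 ∣ v]/6`, the slope `shaSlope v = 1 + [6 ∣ v]`,
  their values on `v ∈ {4, 6, 10, 12}` (Kodaira II, IV, IV*, II*), and the identity behind
  O6-TOWERS (4.1), `φ(3^n)·(ℓ(v) − v/12) = m(v)·3^{n−2}` — proved here for EVERY `v` and `n ≥ 2`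
  (o6-r1 had the twelve cases `v ∈ {4,6,10,12}`, `n ∈ {2,3,4}`);
* §2 the interface `TowerValuation W` (fields `nu : ℕ → Option ℚ`, `piDivisible : ℕ → Prop`;
  definition request D-O6-ν), its CONSTRUCTION shape `TowerValuation.RealisedShape real` over an
  interface predicate `real` (a hypothesis schema, NOT a conjecture node: for an arbitrary `real` it is
  not a meaningful statement), and the tree-vocabulary compatibility predicate
  `TowerValuation.PiDivisibleReadsOmegaDvd` pinning `piDivisible k` to `ω_{k−1} ∣ θ_k(f, 3)`
  (`mazurTateElement`, `cyclotomicOmega` of `PlusMinusPAdicLFunction.lean`);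
* §3 the interface `IsogenyLevelDatum W` (profile of the rational `3`-power isogeny class; definition
  request D-O6-prof — Mathlib has neither rational isogeny classes nor Néron periods over `ℚ` as
  objects), the effective level `effectiveLevel D = max(ℓ(v₃Δ_W), max_{W̃}(ℓ(v₃Δ_W̃) + shift))` (the
  v2/v3 isogeny-class MAX level rule, as a DEFINITION), `shaSlopeV2`, the four census class shapes
  `effectiveLevel_shapes`, and the construction shape `IsogenyLevelDatum.RealisedShape realLevel`.

Namespace: `Summit.BirchSwinnertonDyer.Rank1Residual.O6` (the O6 typed files `O6Targets.lean`,
`JointClosure.lean`); o6-r1's sketch namespace `…Additive.O6Towers` is not used in the tree.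
References: B. Mazur, J. Tate, Duke Math. J. 54 (1987) §1 [MazurTate1987]; A. Doyon, A. Lei, Ramanujan
J. 58 (2022) Lemma 5.2, Cor. 5.3 [DoyonLei2021]; A. Lei, R. Pollack, N. Pratap, arXiv:2412.16629 Lemma 5.1,
§4 [LeiPollackPratap2024]; R. Pollack, Duke Math. J. 118 (2003) Def. 6.15 [Pollack2003].
-/

set_option autoImplicit false

noncomputable section

open scoped Classical

open Polynomial WeierstrassCurve Literature.NumberTheory.EllipticCurves
  Literature.NumberTheory.EllipticCurves.Rank1Residual
  Literature.NumberTheory.EllipticCurves.Rank1Residual.Typed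
  Summit.BirchSwinnertonDyer.Rank1Residual.Additive

namespace Summit.BirchSwinnertonDyer.Rank1Residual.O6

/-! ## §1 The Kodaira offset `ℓ` and the slope `m` (functions of `v₃(Δ_min)` alone; pure arithmetic) -/

/-- `ℓ(v) = (v + 2)/12 + [6 ∣ v]/6` — the Kodaira OFFSET of the tower valuation: on the cyclic wild cell
`v = v₃(Δ_min) ∈ {4, 6, 10, 12}` (Kodaira `II, IV, IV*, II*`) it takes the values `1/2, 5/6, 1, 4/3`.
(o6-r1 O6-TOWERS §3; the base term of every version of T-O6-ν.) [folklore] -/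
def kodairaOffset (v : ℕ) : ℚ := ((v : ℚ) + 2) / 12 + (if 6 ∣ v then (1 : ℚ) / 6 else 0)

/-- `m(v) = 1 + [6 ∣ v] ∈ {1, 2}` — the conjectured growth SLOPE of `#Ш(E/k_n)[3^∞]` (increments
`m·3^{n−2} + O(1)` per layer, "`μ_eff = m/6`"; O6-TOWERS (4.1)). [folklore] -/
def shaSlope (v : ℕ) : ℕ := if 6 ∣ v then 2 else 1

/-- The four Kodaira values of the offset. [folklore] -/
theorem kodairaOffset_values :
    kodairaOffset 4 = 1 / 2 ∧ kodairaOffset 6 = 5 / 6 ∧ kodairaOffset 10 = 1 ∧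
      kodairaOffset 12 = 4 / 3 := by
  refine ⟨?_, ?_, ?_, ?_⟩ <;> norm_num [kodairaOffset]

/-- The four Kodaira values of the slope. [folklore] -/
theorem shaSlope_values : shaSlope 4 = 1 ∧ shaSlope 6 = 2 ∧ shaSlope 10 = 1 ∧ shaSlope 12 = 2 := by
  refine ⟨?_, ?_, ?_, ?_⟩ <;> decide

/-- `ℓ(v) − v/12 = m(v)/6` for every `v`. [folklore] -/
theorem kodairaOffset_sub_eq (v : ℕ) : kodairaOffset v - (v : ℚ) / 12 = (shaSlope v : ℚ) / 6 := by
  unfold kodairaOffset shaSlope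
  split_ifs <;> push_cast <;> ring

/-- **The identity behind O6-TOWERS (4.1)** — the period term and the Ш-slope split:
`φ(3^n)·(ℓ(v) − v/12) = m(v)·3^{n−2}` for EVERY `v` and every `n ≥ 2` (o6-r1 checked the twelve cases
`v ∈ {4,6,10,12}`, `n ∈ {2,3,4}`; here in general: `φ(3^n) = 2·3^{n−1}` and `ℓ(v) − v/12 = m(v)/6`).
[folklore] -/
theorem period_sha_split (v n : ℕ) (hn : 2 ≤ n) :
    (Nat.totient (3 ^ n) : ℚ) * (kodairaOffset v - (v : ℚ) / 12) = (shaSlope v : ℚ) * 3 ^ (n - 2) := by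
  rw [kodairaOffset_sub_eq, Nat.totient_prime_pow Nat.prime_three (by omega)]
  obtain ⟨k, rfl⟩ : ∃ k, n = k + 2 := ⟨n - 2, by omega⟩
  simp only [Nat.add_sub_cancel, show k + 2 - 1 = k + 1 from rfl]
  push_cast
  ring

/-! ## §2 Interface: the tower valuation datum (definition request D-O6-ν) -/

/-- **D-O6-ν (interface).** For an elliptic curve `W/ℚ` with `a₃(W) = 0` and `9 ∣ N_W`: `nu k = some q`
means that for EVERY even primitive Dirichlet character `ψ` of conductor `3^{k+1}` the algebraic
number `τ(ψ)·L(W, ψ̄, 1)/Ω⁺_W` is non-zero of `3`-adic valuation exactly `q` (the valuation is the same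
for all such `ψ`: O6-TOWERS (3.1), because `θ_k = ω_{k−1}·u_k` with `deg u_k < φ(3^k)`); `nu k = none`
means `θ_k(W) = 0` (all those `L`-values vanish). `piDivisible k` records `π_{k→k−1} θ_k = 0`, i.e.
`ω_{k−1} ∣ θ_k` (Doyon–Lei Lemma 5.2 / proof of Cor. 5.3, Lei–Pollack–Pratap Lemma 5.1, when `a₃ = 0`,
`9 ∣ N`; typed for the whole additive locus as `Additive.OmegaDvdMazurTateOfAddv`). The structure only
NAMES the datum; that the modular-symbol construction provides it is the separate construction shape
`TowerValuation.RealisedShape`; its reading in tree vocabulary is `PiDivisibleReadsOmegaDvd`.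
[cite: MazurTate1987, §1] [cite: DoyonLei2021, Lemma 5.2] [cite: LeiPollackPratap2024, Lemma 5.1] -/
structure TowerValuation (W : WeierstrassCurve ℚ) where
  /-- `ν_k(W)`, `k ≥ 1`; `none` iff `θ_k(W) = 0`. -/
  nu : ℕ → Option ℚ
  /-- `π_{k → k−1}(θ_k) = 0` at layer `k`. -/
  piDivisible : ℕ → Prop

/-- **CONSTRUCTION shape for D-O6-ν (separate from the interface; a hypothesis SCHEMA over the interface
predicate `real`, not a conjecture node).** `real W T` is the (to-be-defined) predicate "`T` is the tower
valuation datum of `W` computed from the modular symbol `x⁺_W`"; the construction statement is that such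
a datum exists and is unique on the wild cell at `3`. Nothing asserted. [folklore] -/
def TowerValuation.RealisedShape
    (real : ∀ (W : WeierstrassCurve ℚ) [W.IsElliptic] [W.IsGloballyMinimal], TowerValuation W → Prop) :
    Prop :=
  ∀ (W : WeierstrassCurve ℚ) [W.IsElliptic] [W.IsGloballyMinimal],
    Addv W 3 → SubW W 3 → ∃! T : TowerValuation W, real W T

/-- **The `piDivisible` bit in TREE vocabulary.** A tower datum `T` of `W` READS `ω`-divisibility off the
newform `f` of `W` when, for every `k ≥ 1`, `T.piDivisible k ↔ ω_{k−1} ∣ θ_k(f)` with the tree's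
`mazurTateElement f 3 k ∈ ℚ[X]` (Pollack 2003 Def. 6.15, degree `< 3^k` representative) and
`cyclotomicOmega 3 (k−1) = (1+X)^{3^{k−1}} − 1`. Under `Additive.OmegaDvdMazurTateOfAddv` every such
datum has `piDivisible k` for all `k ≥ 1` on the additive locus at `3`. A compatibility predicate;
nothing asserted. [cite: Pollack2003, Def. 6.15] -/
def TowerValuation.PiDivisibleReadsOmegaDvd {W : WeierstrassCurve ℚ} (T : TowerValuation W) {N : ℕ}
    (f : CuspForm (CongruenceSubgroup.Gamma0 N) 2) : Prop :=
  ∀ k : ℕ, 1 ≤ k →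
    (T.piDivisible k ↔ (cyclotomicOmega 3 (k - 1)).map (Int.castRingHom ℚ) ∣ mazurTateElement f 3 k)

/-- Unfolding of the compatibility predicate. [folklore] -/
theorem TowerValuation.piDivisible_iff_of_reads {W : WeierstrassCurve ℚ} {T : TowerValuation W} {N : ℕ}
    {f : CuspForm (CongruenceSubgroup.Gamma0 N) 2} (h : T.PiDivisibleReadsOmegaDvd f) (k : ℕ)
    (hk : 1 ≤ k) :
    T.piDivisible k ↔
      (cyclotomicOmega 3 (k - 1)).map (Int.castRingHom ℚ) ∣ mazurTateElement f 3 k :=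
  h k hk

/-! ## §3 Interface: the isogeny-class level profile (definition request D-O6-prof) and the effective
level `ℓ′` — the isogeny-class MAX level rule as a DEFINITION -/

/-- **D-O6-prof (interface).** The finite profile of the rational `3`-power isogeny class of `W`: one pair
`(v₃Δ_min(W̃), v₃(Ω⁺_W̃ / Ω⁺_W))` per class member `W̃ ≠ W` (`W` itself contributes `(v₃Δ_min W, 0)`, added
by `effectiveLevel`). For the census curves the class has size `≤ 2` and the shift is `0` or `−1`
(held-out finding, kit j121686 + isogeny classes j122604). Mathlib has neither rational isogeny classes
nor real periods of elliptic curves over `ℚ` as objects, so the profile is an interface datum realised by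
a separate construction shape — nothing about its existence is smuggled into the level rule. [folklore] -/
structure IsogenyLevelDatum (W : WeierstrassCurve ℚ) where
  /-- `(v₃ Δ_min(W̃), v₃(Ω⁺_{W̃}/Ω⁺_W))` for the class members `W̃ ≠ W`. -/
  profile : List (ℕ × ℤ)

/-- **The effective level `ℓ′(W) = max(ℓ(v₃Δ_W), max_{W̃} (ℓ(v₃Δ_W̃) + shift))`** — the isogeny-class MAX
level rule of T-O6-ν v2/v3 (O6-TOWERS §3bis), as a definition on the interface datum. [folklore] -/
def effectiveLevel {W : WeierstrassCurve ℚ} [W.IsElliptic] [W.IsGloballyMinimal]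
    (D : IsogenyLevelDatum W) : ℚ :=
  (D.profile.map fun q => kodairaOffset q.1 + (q.2 : ℚ)).foldr max
    (kodairaOffset (padicValInt 3 W.minimalDiscriminantInt))

/-- `m′(W) = 6ℓ′(W) − v₃Δ_W/2`: the Ш-growth slope read with the effective level (`∈ {1, 2, 3, 6}` on the
census curves). [folklore] -/
def shaSlopeV2 {W : WeierstrassCurve ℚ} [W.IsElliptic] [W.IsGloballyMinimal]
    (D : IsogenyLevelDatum W) : ℚ :=
  6 * effectiveLevel D - (padicValInt 3 W.minimalDiscriminantInt : ℚ) / 2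

/-- With an EMPTY profile (singleton isogeny class) the effective level is the Kodaira offset of `W`
itself. [folklore] -/
theorem effectiveLevel_nil {W : WeierstrassCurve ℚ} [W.IsElliptic] [W.IsGloballyMinimal] :
    effectiveLevel (W := W) ⟨[]⟩ = kodairaOffset (padicValInt 3 W.minimalDiscriminantInt) := rfl

/-- The four class shapes met in the census (136 classes of size 2 + 11 singletons), as pure arithmetic on
profiles: Kodaira II with the II* partner of period `Ω/3` keeps `½`; with EQUAL period it is promoted to
`4/3`; likewise IV: `5/6` vs `1`. (Values of the fold for explicit profiles and base offsets.) [folklore] -/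
theorem effectiveLevel_shapes :
    (([((12 : ℕ), (-1 : ℤ))].map fun q => kodairaOffset q.1 + (q.2 : ℚ)).foldr max (kodairaOffset 4)
        = 1 / 2) ∧
    (([((12 : ℕ), (0 : ℤ))].map fun q => kodairaOffset q.1 + (q.2 : ℚ)).foldr max (kodairaOffset 4)
        = 4 / 3) ∧
    (([((10 : ℕ), (-1 : ℤ))].map fun q => kodairaOffset q.1 + (q.2 : ℚ)).foldr max (kodairaOffset 6)
        = 5 / 6) ∧
    (([((10 : ℕ), (0 : ℤ))].map fun q => kodairaOffset q.1 + (q.2 : ℚ)).foldr max (kodairaOffset 6)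
        = 1) := by
  simp only [List.map, List.foldr, kodairaOffset]
  norm_num

/-- **CONSTRUCTION shape for D-O6-prof (separate from the interface; hypothesis schema over `realLevel`).**
The profile computed from the rational `3`-power isogeny class and Néron periods exists and is unique on
the wild cell at `3`. Nothing asserted. [folklore] -/
def IsogenyLevelDatum.RealisedShape
    (realLevel : ∀ (W : WeierstrassCurve ℚ) [W.IsElliptic] [W.IsGloballyMinimal],
      IsogenyLevelDatum W → Prop) : Prop :=
  ∀ (W : WeierstrassCurve ℚ) [W.IsElliptic] [W.IsGloballyMinimal],
    Addv W 3 → SubW W 3 → ∃! D : IsogenyLevelDatum W, realLevel W D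

end Summit.BirchSwinnertonDyer.Rank1Residual.O6

end
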